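import Summits.CriticalPhenomena.PercolationContinuityZ3.Theorems.Transplant.CayleyCylinderKit
import HarnessLib

/-!
# Cylinders of a Cayley-graph skeleton VIII — kernels generated by SHORT kernel elements (thick frames, I)

builds on p205010 (kernel theorem, internal audit signed; external expert review pending) — nothing in this file uses p205010.
Lane `prim-bschramm`, seat `prim-bschramm-p4` gen 11 (PART C3 of `P4-GENERAL.md`, "thick frames").  Helper file
(`--supports stmt-CriticalPhenomena-4575 --as helper`).

Files I–VII (`CylData`, `CylData₁`) need `ker φ` generated by kernel LETTERS, resp. by kernel letters and corner-admissible commutator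
words, because the enhancement frame of the strict inequality `p_c(C_{ℓ+1}) < p_c(C_ℓ)` is ONE shell thick.  This file starts the
THICK-FRAME version: the datum `CylData₂` only asks that `ker φ` be generated by kernel elements of `S`-length `≤ r` (`shortKer`) —
equivalently, that SOME cylinder `C_d` be connected; automatic when `ker φ` is finitely generated.  Outputs: the base datum `CylBase`
(skeleton homomorphism and unit steps, no kernel hypothesis) with the kernel projection `proj g = g s₁^{−φ₁ g} s₀^{−φ₀ g}` and the
TELESCOPING LEMMA (`CylBase.mem_closure_shortKer_of_walk`: a kernel element joined to `1` inside `C_d` is a product of kernel elements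
of length `≤ 4d+1`), hence the constructor `CylBase.toCylData₂`; for `D : CylData₂ Γ S` the enlarged letter set `Sp = S ∪ Kfin`
carrying an honest `CylData` (`enl`, through which the `φ`-bookkeeping of files I–III is reused), and for every `k ∈ ker φ` a walk
`boxWalk k : 1 → k` of `Cay(Γ;S)` inside the cylinder `‖φ‖_∞ ≤ r` (`boxWalk_inBox`) — the excursion of the thick frame of file IX.
-/

noncomputable section

namespace Summit.CriticalPhenomena.PercolationContinuityZ3.Theorems.Transplant

namespace CayCyl

open SimpleGraph Walk Literature.Probability.LatticeModels
open Literature.Barriers.CriticalPhenomena (graphBall graphBall_mono mem_graphBall_self graphBall_finite)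
open scoped Classical

variable {Γ : Type} [Group Γ] {S : Finset Γ}

/-! ## §1 Integer power walks -/

/-- A walk `g → g t^z` of length `≤ |z|` along a generator `t ∈ S`, `t ≠ 1`. [folklore] -/
theorem exists_walk_mul_zpow {t : Γ} (ht : t ∈ S) (ht1 : t ≠ 1) (g : Γ) (z : ℤ) :
    ∃ w : (mulCayley (S : Set Γ)).Walk g (g * t ^ z), w.length ≤ z.natAbs := by
  rcases z with n | n
  · refine ⟨(powWalk S (adj_mul_of_mem S (Or.inl ht) ht1) g n).copy rfl (by simp), ?_⟩
    rw [length_copy, length_powWalk]; simp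
  · refine ⟨(powWalk S (adj_mul_of_mem S (t := t⁻¹) (Or.inr (by rw [inv_inv]; exact ht)) (inv_ne_one.2 ht1)) g (n + 1)).copy rfl
      (by rw [zpow_negSucc, inv_pow]), ?_⟩
    rw [length_copy, length_powWalk]; simp

/-! ## §2 The base datum, short kernel elements, the kernel projection -/

/-- **Short kernel elements**: elements of `ker φ` in the ball of radius `r` of `Cay(Γ; S)` about `1`. [folklore] -/
def shortKer (φ : Γ → Site 2) (S : Finset Γ) (r : ℕ) : Set Γ := {k | φ k = 0 ∧ k ∈ graphBall (mulCayley (S : Set Γ)) (1 : Γ) r}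

/-- **BASE DATUM of a rank-2 skeleton on `Cay(Γ; S)`**: an additive `φ : Γ → ℤ²` of sup-norm `≤ 1` on `S` and unit-step generators
`s₀, s₁ ∈ S` — no kernel hypothesis. [cite: BenjaminiSchramm1996, §2 (Cayley graphs)] [cite: KozmaNitzan2024, §4 p. 16 (Lemma 8)] -/
structure CylBase (Γ : Type) [Group Γ] (S : Finset Γ) where
  /-- the skeleton homomorphism -/
  φ : Γ → Site 2
  /-- additivity -/
  map_mul : ∀ g h : Γ, φ (g * h) = φ g + φ h
  /-- generators have sup-norm `≤ 1` -/
  lip : ∀ s ∈ S, ∀ i : Fin 2, |φ s i| ≤ 1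
  /-- the unit step in direction `0` -/
  s₀ : Γ
  /-- it is a generator -/
  s₀_mem : s₀ ∈ S
  /-- its height -/
  φ_s₀ : φ s₀ = Pi.single 0 1
  /-- the unit step in direction `1` -/
  s₁ : Γ
  /-- it is a generator -/
  s₁_mem : s₁ ∈ S
  /-- its height -/
  φ_s₁ : φ s₁ = Pi.single 1 1

namespace CylBase

variable (B : CylBase Γ S)

/-- `φ 1 = 0`. [folklore] -/
theorem φ_one : B.φ 1 = 0 := by
  have h := B.map_mul 1 1; rw [one_mul] at h; exact left_eq_add.1 h

/-- `φ (g⁻¹) = −φ g`. [folklore] -/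
theorem φ_inv (g : Γ) : B.φ g⁻¹ = -B.φ g := by
  have h := B.map_mul g⁻¹ g; rw [inv_mul_cancel, φ_one] at h; exact eq_neg_of_add_eq_zero_left h.symm

/-- Heights of integer powers. [folklore] -/
theorem φ_zpow (t : Γ) (z : ℤ) : B.φ (t ^ z) = z • B.φ t := by
  induction z using Int.induction_on with
  | zero => rw [zpow_zero, φ_one, zero_smul]
  | succ n ih => rw [zpow_add_one, B.map_mul, ih, add_smul, one_smul]
  | pred n ih => rw [zpow_sub_one, B.map_mul, ih, φ_inv, sub_smul, one_smul, sub_eq_add_neg]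

/-- `s₀ ≠ 1`. [folklore] -/
theorem s₀_ne_one : B.s₀ ≠ 1 := fun h => by have := congrFun B.φ_s₀ 0; rw [h, φ_one] at this; simp at this

/-- `s₁ ≠ 1`. [folklore] -/
theorem s₁_ne_one : B.s₁ ≠ 1 := fun h => by have := congrFun B.φ_s₁ 1; rw [h, φ_one] at this; simp at this

/-- The sup-norm of `φ` changes by at most one along an edge. [folklore] -/
theorem lip_adj {u v : Γ} (h : (mulCayley (S : Set Γ)).Adj u v) (i : Fin 2) : |B.φ v i - B.φ u i| ≤ 1 := by
  rw [mulCayley_adj] at h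
  obtain ⟨-, h | h⟩ := h
  · have h1 := B.lip _ (Finset.mem_coe.1 h) i
    rwa [B.map_mul, φ_inv, Pi.add_apply, Pi.neg_apply, neg_add_eq_sub] at h1
  · have h1 := B.lip _ (Finset.mem_coe.1 h) i
    rwa [B.map_mul, φ_inv, Pi.add_apply, Pi.neg_apply, neg_add_eq_sub, abs_sub_comm] at h1

/-- Along a walk, `φ` moves by at most the length in each coordinate. [folklore] -/
theorem abs_sub_le_length {u v : Γ} (w : (mulCayley (S : Set Γ)).Walk u v) (i : Fin 2) : |B.φ v i - B.φ u i| ≤ w.length := by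
  induction w with
  | nil => simp
  | @cons a b c h p ih =>
    rw [length_cons]; push_cast
    have h1 := B.lip_adj h i
    calc |B.φ c i - B.φ a i| = |(B.φ c i - B.φ b i) + (B.φ b i - B.φ a i)| := by ring_nf
      _ ≤ |B.φ c i - B.φ b i| + |B.φ b i - B.φ a i| := abs_add_le _ _
      _ ≤ p.length + 1 := by linarith

/-- A walk INSIDE THE CYLINDER `‖φ‖_∞ ≤ d`: all its vertices have `φ ∈ box d`. [folklore] -/
def InBox (d : ℕ) {u v : Γ} (w : (mulCayley (S : Set Γ)).Walk u v) : Prop := ∀ z ∈ w.support, B.φ z ∈ box 2 d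

/-- Vertices of a walk of length `≤ d` from `1` lie in the cylinder `‖φ‖_∞ ≤ d`. [folklore] -/
theorem inBox_of_length_le {d : ℕ} {k : Γ} (w : (mulCayley (S : Set Γ)).Walk (1 : Γ) k) (hw : w.length ≤ d) : B.InBox d w := by
  intro z hz
  have h := fun i => B.abs_sub_le_length (w.takeUntil z hz) i
  have hl := w.length_takeUntil_le_length hz
  rw [mem_box]
  intro i
  have hi := h i
  rw [φ_one, Pi.zero_apply, sub_zero, abs_le] at hi
  have hl' : ((w.takeUntil z hz).length : ℤ) ≤ d := by exact_mod_cast hl.trans hw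
  constructor <;> linarith [hi.1, hi.2]

/-- **The kernel projection** `proj g = g s₁^{−φ₁ g} s₀^{−φ₀ g}`. [folklore] -/
def proj (g : Γ) : Γ := g * B.s₁ ^ (-(B.φ g 1)) * B.s₀ ^ (-(B.φ g 0))

/-- `proj g ∈ ker φ`. [folklore] -/
theorem φ_proj (g : Γ) : B.φ (B.proj g) = 0 := by
  rw [proj, B.map_mul, B.map_mul, φ_zpow, φ_zpow, B.φ_s₀, B.φ_s₁]
  funext i; fin_cases i <;> simp

/-- `proj k = k` on the kernel. [folklore] -/
theorem proj_of_ker {k : Γ} (hk : B.φ k = 0) : B.proj k = k := by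
  rw [proj, hk]; simp

/-- **One step of the telescope**: for adjacent `u, u'` in the cylinder `‖φ‖_∞ ≤ d`, `(proj u)⁻¹ proj u'` is a kernel element of
length `≤ 4d + 1`. [folklore] -/
theorem proj_step_mem_shortKer {d : ℕ} {u u' : Γ} (h : (mulCayley (S : Set Γ)).Adj u u') (hu : B.φ u ∈ box 2 d)
    (hu' : B.φ u' ∈ box 2 d) : (B.proj u)⁻¹ * B.proj u' ∈ shortKer B.φ S (4 * d + 1) := by
  refine ⟨by rw [B.map_mul, φ_inv, φ_proj, φ_proj, neg_zero, add_zero], ?_⟩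
  rw [mem_box] at hu hu'
  have ha := hu 0; have hb := hu 1; have ha' := hu' 0; have hb' := hu' 1
  -- the walk `proj u → u s₁^{-φ₁ u} → u → u' → u' s₁^{-φ₁ u'} → proj u'`
  obtain ⟨w₁, hw₁⟩ := exists_walk_mul_zpow B.s₀_mem B.s₀_ne_one (B.proj u) (B.φ u 0)
  obtain ⟨w₂, hw₂⟩ := exists_walk_mul_zpow B.s₁_mem B.s₁_ne_one (u * B.s₁ ^ (-(B.φ u 1))) (B.φ u 1)
  obtain ⟨w₃, hw₃⟩ := exists_walk_mul_zpow B.s₁_mem B.s₁_ne_one u' (-(B.φ u' 1))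
  obtain ⟨w₄, hw₄⟩ := exists_walk_mul_zpow B.s₀_mem B.s₀_ne_one (u' * B.s₁ ^ (-(B.φ u' 1))) (-(B.φ u' 0))
  have e₁ : B.proj u * B.s₀ ^ (B.φ u 0) = u * B.s₁ ^ (-(B.φ u 1)) := by
    rw [proj, mul_assoc, ← zpow_add, neg_add_cancel, zpow_zero, mul_one]
  have e₂ : u * B.s₁ ^ (-(B.φ u 1)) * B.s₁ ^ (B.φ u 1) = u := by
    rw [mul_assoc, ← zpow_add, neg_add_cancel, zpow_zero, mul_one]
  let W : (mulCayley (S : Set Γ)).Walk (B.proj u) (B.proj u') :=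
    (w₁.copy rfl e₁).append ((w₂.copy rfl e₂).append (Walk.cons h (w₃.append (w₄.copy rfl rfl))))
  refine ⟨(lmul S (B.proj u)⁻¹ W).copy (inv_mul_cancel _) rfl, ?_⟩
  rw [length_copy, length_lmul]
  simp only [W, Walk.length_append, Walk.length_copy, Walk.length_cons]
  have h1 : (w₁.length : ℤ) ≤ d := by
    have := hw₁; have habs : ((B.φ u 0).natAbs : ℤ) ≤ d := by rw [Int.natCast_natAbs, abs_le]; exact ha
    exact_mod_cast this.trans (by exact_mod_cast habs)
  have h2 : (w₂.length : ℤ) ≤ d := by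
    have := hw₂; have habs : ((B.φ u 1).natAbs : ℤ) ≤ d := by rw [Int.natCast_natAbs, abs_le]; exact hb
    exact_mod_cast this.trans (by exact_mod_cast habs)
  have h3 : (w₃.length : ℤ) ≤ d := by
    have := hw₃; have habs : ((-(B.φ u' 1)).natAbs : ℤ) ≤ d := by rw [Int.natCast_natAbs, abs_neg, abs_le]; exact hb'
    exact_mod_cast this.trans (by exact_mod_cast habs)
  have h4 : (w₄.length : ℤ) ≤ d := by
    have := hw₄; have habs : ((-(B.φ u' 0)).natAbs : ℤ) ≤ d := by rw [Int.natCast_natAbs, abs_neg, abs_le]; exact ha'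
    exact_mod_cast this.trans (by exact_mod_cast habs)
  omega

/-- **TELESCOPING LEMMA**: along a walk inside the cylinder `‖φ‖_∞ ≤ d`, `(proj u)⁻¹ proj v` is a product of kernel elements of
length `≤ 4d + 1`. [folklore] -/
theorem mem_closure_shortKer_of_walk {d : ℕ} {u v : Γ} (w : (mulCayley (S : Set Γ)).Walk u v) (hw : B.InBox d w) :
    (B.proj u)⁻¹ * B.proj v ∈ Subgroup.closure (shortKer B.φ S (4 * d + 1)) := by
  induction w with
  | nil => rw [inv_mul_cancel]; exact one_mem _
  | @cons a b c h p ih =>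
    have hab : (B.proj a)⁻¹ * B.proj c = ((B.proj a)⁻¹ * B.proj b) * ((B.proj b)⁻¹ * B.proj c) := by group
    rw [hab]
    refine mul_mem (Subgroup.subset_closure (B.proj_step_mem_shortKer h ?_ ?_)) (ih fun z hz => hw z ?_)
    · exact hw a (Walk.start_mem_support _)
    · exact hw b (by rw [support_cons]; exact List.mem_cons_of_mem _ (Walk.start_mem_support _))
    · rw [support_cons]; exact List.mem_cons_of_mem _ hz

/-- **A kernel element joined to `1` inside the cylinder `‖φ‖_∞ ≤ d` is generated by kernel elements of length `≤ 4d + 1`.** [folklore] -/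
theorem mem_closure_shortKer {d : ℕ} {k : Γ} (hk : B.φ k = 0) (w : (mulCayley (S : Set Γ)).Walk (1 : Γ) k) (hw : B.InBox d w) :
    k ∈ Subgroup.closure (shortKer B.φ S (4 * d + 1)) := by
  have h := B.mem_closure_shortKer_of_walk w hw
  rwa [B.proj_of_ker B.φ_one, inv_one, one_mul, B.proj_of_ker hk] at h

end CylBase

/-! ## §3 The datum `CylData₂` and the enlarged letter set -/

/-- **CYLINDER DATA WITH A KERNEL GENERATED BY SHORT ELEMENTS**: a `CylBase` plus a radius `r` such that `ker φ` is generated by the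
kernel elements of the ball of radius `r` of `Cay(Γ; S)` — equivalently some cylinder is connected (`CylBase.toCylData₂`); automatic
when `ker φ` is finitely generated and `S` generates. [cite: KozmaNitzan2024, §4 p. 16 (Lemma 8)] [cite: BenjaminiSchramm1996, §2] -/
structure CylData₂ (Γ : Type) [Group Γ] (S : Finset Γ) extends CylBase Γ S where
  /-- the radius -/
  r : ℕ
  /-- the kernel is generated by the kernel elements of length `≤ r` -/
  ker_short : ∀ k : Γ, φ k = 0 → k ∈ Subgroup.closure (shortKer φ S r)

/-- **Constructor**: a base datum all of whose kernel elements are joined to `1` inside the cylinder `‖φ‖_∞ ≤ d` (e.g. `C_d` connected)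
is a `CylData₂` of radius `4d + 1`. [folklore] -/
def CylBase.toCylData₂ (B : CylBase Γ S) (d : ℕ)
    (h : ∀ k : Γ, B.φ k = 0 → ∃ w : (mulCayley (S : Set Γ)).Walk (1 : Γ) k, B.InBox d w) : CylData₂ Γ S where
  toCylBase := B
  r := 4 * d + 1
  ker_short := fun k hk => by obtain ⟨w, hw⟩ := h k hk; exact B.mem_closure_shortKer hk w hw

namespace CylData₂

variable (D : CylData₂ Γ S)

/-- The short kernel elements as a finite set. [folklore] -/
def Kfin : Finset Γ := (graphBall_finite (mulCayley (S : Set Γ)) (1 : Γ) D.r).toFinset.filter fun k => D.φ k = 0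

/-- Membership in `Kfin`. [folklore] -/
theorem mem_Kfin {k : Γ} : k ∈ D.Kfin ↔ k ∈ shortKer D.φ S D.r := by
  rw [Kfin, Finset.mem_filter, Set.Finite.mem_toFinset]; exact and_comm

/-- **The enlarged letter set** `S⁺ = S ∪ Kfin`. [folklore] -/
def Sp : Finset Γ := S ∪ D.Kfin

/-- Letters of `S` are letters of `S ∪ Kfin`. [folklore] -/
theorem mem_Sp {s : Γ} (hs : s ∈ S) : s ∈ D.Sp := Finset.mem_union_left _ hs

/-- **The enlarged datum is a `CylData`** (the kernel letters of `S⁺` generate `ker φ`). [folklore] -/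
def enl : CylData Γ D.Sp where
  φ := D.φ
  map_mul := D.map_mul
  lip := fun s hs i => by
    rcases Finset.mem_union.1 hs with hs | hs
    · exact D.lip s hs i
    · rw [(D.mem_Kfin.1 hs).1]; simp
  s₀ := D.s₀
  s₀_mem := D.mem_Sp D.s₀_mem
  φ_s₀ := D.φ_s₀
  s₁ := D.s₁
  s₁_mem := D.mem_Sp D.s₁_mem
  φ_s₁ := D.φ_s₁
  ker_gen := fun k hk => by
    refine (Subgroup.closure_mono ?_) (D.ker_short k hk)
    intro g hg
    exact Finset.mem_coe.2 (Finset.mem_filter.2 ⟨Finset.mem_union_right _ (D.mem_Kfin.2 hg), hg.1⟩)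

/-- `enl.φ = φ` (the base datum's skeleton map). [folklore] -/
@[simp] theorem enl_φ : D.enl.φ = D.toCylBase.φ := rfl
/-- `enl.s₀ = s₀` (the base datum's first unit step). [folklore] -/
@[simp] theorem enl_s₀ : D.enl.s₀ = D.toCylBase.s₀ := rfl
/-- `enl.s₁ = s₁` (the base datum's second unit step). [folklore] -/
@[simp] theorem enl_s₁ : D.enl.s₁ = D.toCylBase.s₁ := rfl

/-- Edges of `Cay(Γ;S)` are edges of `Cay(Γ;S ∪ Kfin)`. [folklore] -/
theorem adj_enl {a b : Γ} (hab : (mulCayley (S : Set Γ)).Adj a b) : (mulCayley (↑D.Sp : Set Γ)).Adj a b := by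
  rw [mulCayley_adj] at hab ⊢
  obtain ⟨hne, h | h⟩ := hab
  · exact ⟨hne, Or.inl (Finset.mem_coe.2 (D.mem_Sp (Finset.mem_coe.1 h)))⟩
  · exact ⟨hne, Or.inr (Finset.mem_coe.2 (D.mem_Sp (Finset.mem_coe.1 h)))⟩

/-! ## §4 Kernel walks inside the cylinder `‖φ‖_∞ ≤ r` -/

/-- `InBox` is preserved by left translation by a kernel element. [folklore] -/
theorem inBox_lmul {d : ℕ} {x u v : Γ} (hx : D.φ x = 0) {w : (mulCayley (S : Set Γ)).Walk u v} (hw : D.InBox d w) :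
    D.InBox d (lmul S x w) := by
  intro z hz
  obtain ⟨z', hz', rfl⟩ := mem_support_lmul.1 hz
  rw [D.map_mul, hx, zero_add]; exact hw z' hz'

/-- `InBox` of an appended walk. [folklore] -/
theorem inBox_append {d : ℕ} {u v x : Γ} {w₁ : (mulCayley (S : Set Γ)).Walk u v} {w₂ : (mulCayley (S : Set Γ)).Walk v x}
    (h₁ : D.InBox d w₁) (h₂ : D.InBox d w₂) : D.InBox d (w₁.append w₂) := by
  intro z hz
  rw [support_append, List.mem_append] at hz
  rcases hz with hz | hz
  · exact h₁ z hz
  · exact h₂ z (List.tail_subset _ hz)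

/-- `InBox` of a reversed walk. [folklore] -/
theorem inBox_reverse {d : ℕ} {u v : Γ} {w : (mulCayley (S : Set Γ)).Walk u v} (h : D.InBox d w) : D.InBox d w.reverse :=
  fun z hz => h z ((mem_support_reverse_iff w z).1 hz)

/-- `InBox` of a copied walk. [folklore] -/
theorem inBox_copy {d : ℕ} {u v u' v' : Γ} {w : (mulCayley (S : Set Γ)).Walk u v} (hu : u = u') (hv : v = v') (h : D.InBox d w) :
    D.InBox d (w.copy hu hv) := by subst hu hv; exact h

/-- **KERNEL WALKS IN THE CYLINDER**: every `k ∈ ker φ` is joined to `1` by a walk of `Cay(Γ;S)` inside `‖φ‖_∞ ≤ r` (closure induction: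
generators by short walks, products by concatenating kernel translates, inverses by reversing). [folklore] -/
theorem exists_boxWalk (k : Γ) (hk : D.φ k = 0) : ∃ w : (mulCayley (S : Set Γ)).Walk (1 : Γ) k, D.InBox D.r w := by
  have h1 : D.φ 1 = 0 := D.φ_one
  have triv : ∃ w : (mulCayley (S : Set Γ)).Walk (1 : Γ) 1, D.InBox D.r w :=
    ⟨Walk.nil, fun z hz => by simp at hz; subst hz; rw [h1]; exact zero_mem_box 2 _⟩
  suffices H : ∀ g ∈ Subgroup.closure (shortKer D.φ S D.r), D.φ g = 0 ∧ ∃ w : (mulCayley (S : Set Γ)).Walk (1 : Γ) g, D.InBox D.r w from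
    (H k (D.ker_short k hk)).2
  intro g hg
  induction hg using Subgroup.closure_induction with
  | mem x hx =>
      obtain ⟨hx0, w, hw⟩ := hx
      exact ⟨hx0, w, D.inBox_of_length_le w hw⟩
  | one => exact ⟨h1, triv⟩
  | mul x y _ _ hx hy =>
      obtain ⟨hx0, wx, hwx⟩ := hx
      obtain ⟨hy0, wy, hwy⟩ := hy
      exact ⟨by rw [D.map_mul, hx0, hy0, add_zero], wx.append ((lmul S x wy).copy (mul_one x) rfl),
        D.inBox_append hwx (D.inBox_copy _ _ (D.inBox_lmul hx0 hwy))⟩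
  | inv x _ hx =>
      obtain ⟨hx0, wx, hwx⟩ := hx
      have hx0' : D.φ x⁻¹ = 0 := by rw [D.φ_inv, hx0, neg_zero]
      exact ⟨hx0', (lmul S x⁻¹ wx.reverse).copy (inv_mul_cancel x) (mul_one x⁻¹), D.inBox_copy _ _ (D.inBox_lmul hx0' (D.inBox_reverse hwx))⟩

/-- A chosen kernel walk inside the cylinder `‖φ‖_∞ ≤ r`. [folklore] -/
def boxWalk (k : Γ) (hk : D.φ k = 0) : (mulCayley (S : Set Γ)).Walk (1 : Γ) k := Classical.choose (D.exists_boxWalk k hk)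

/-- The chosen walk stays in the cylinder. [folklore] -/
theorem boxWalk_inBox (k : Γ) (hk : D.φ k = 0) : D.InBox D.r (D.boxWalk k hk) := Classical.choose_spec (D.exists_boxWalk k hk)

/-- The length of the chosen walk (`0` off the kernel). [folklore] -/
def boxLen (k : Γ) : ℕ := if hk : D.φ k = 0 then (D.boxWalk k hk).length else 0

/-- `boxLen` is the length of `boxWalk`. [folklore] -/
theorem length_boxWalk (k : Γ) (hk : D.φ k = 0) : (D.boxWalk k hk).length = D.boxLen k := by
  rw [boxLen, dif_pos hk]

end CylData₂

end CayCyl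

end Summit.CriticalPhenomena.PercolationContinuityZ3.Theorems.Transplant

end
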